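import Summits.CriticalPhenomena.PercolationContinuityZ3.Theses.PercShatteringRace
import Summits.CriticalPhenomena.PercolationContinuityZ3.Theses.PercFiniteBoxLRO
import Literature.Probability.Percolation.FiniteEnergy
import Literature.Probability.Percolation.CriticalContinuityProofs
import Literature.Probability.Percolation.SharpnessDCTProofs
import Literature.Probability.Percolation.BKFinitary
import Literature.Probability.Percolation.UniquenessZone

/-!
# `NearLinearTwoClusterDecay` (stmt-CriticalPhenomena-5785) — negative side I: load-bearing hypotheses

Negative-side bookkeeping for the crux `U(1/6)` =
`Summit.CriticalPhenomena.PercolationContinuityZ3.Theses.PercShatteringRace.NearLinearTwoClusterDecay`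
(route `PercShatteringRace`; bond percolation on `ℤ³` at `p_c`: the configuration restricted to
`Λ(m)`, `m = ⌈n^{7/6}⌉`, has two in-box-distinct open clusters each joining `Λ(n)` to `∂ⁱⁿΛ(m)`,
with probability `→ 0`), landed from the standing disprover's work file
`Cruxes/NearLinearTwoClusterDecay/Disproof.lean` (cdisprove v6, refuter-cdisprove-stmt-CriticalPhenomena-5785-0,
sections "Tools", "(a) Load-bearing analysis I/II"), by the line lead (seat c2) of line
`critical-orange-peeling`.  Vocabulary: `twoClusterEvt k m` (the crux event for `(Λ(k), Λ(m))`),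
`AtExponent α` (the crux family, outer box `Λ(⌈n^α⌉)`; the crux is `AtExponent (7/6)` by `Iff.rfl`,
the sibling crux `PercFiniteBoxLRO.CritBoxTwoArmsDecay` (stmt-0859) is `∀ α > 1, AtExponent α`).

* `not_atExponent_of_le_one` — **any proof must use `α > 1`**: for `α ≤ 1` the probability stays
  `≥ (1 - p_c)^6` at every scale (the corner `(m,m,m)` isolated); headline instance
  `nearLinearTwoClusterDecay_false_at_aspect_one`.
* `nearLinearTwoClusterDecay_false_without_arms` — **any proof must use the two arms to `∂ⁱⁿΛ(m)`**:
  dropping them leaves "the origin is isolated", probability `≥ (1 - p_c)^6`.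
-/

namespace Summit.CriticalPhenomena.PercolationContinuityZ3.Theorems.NearLinearTwoClusterDecay.Negative

open MeasureTheory Filter Topology
open Literature.Probability.LatticeModels Literature.Probability.Percolation
open Summit.CriticalPhenomena.PercolationContinuityZ3.Theses

noncomputable section

/-- The critical bond-percolation measure `P_{p_c}` on `ℤ³`. [folklore] -/
abbrev critBond : Measure (BondConfig (Site 3)) := bondPercolation (zdGraph 3) (criticalProbI 3)

/-- The two-distinct-crossing-clusters event of the crux, for inner box `Λ(k)` inside `Λ(m)`:
two sites `x, x' ∈ Λ(k)`, each joined inside `Λ(m)` to the inner vertex boundary of `Λ(m)`,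
but not joined to each other inside `Λ(m)`. [folklore] -/
def twoClusterEvt (k m : ℕ) : Set (BondConfig (Site 3)) :=
  {ω | ∃ x ∈ box 3 k, ∃ x' ∈ box 3 k, ∃ y ∈ innerBoundary (zdGraph 3) (box 3 m),
    ∃ y' ∈ innerBoundary (zdGraph 3) (box 3 m),
      ω ∈ openConnIn ↑(box 3 m) x y ∧ ω ∈ openConnIn ↑(box 3 m) x' y' ∧
        ω ∉ openConnIn ↑(box 3 m) x x'}

/-- The crux family indexed by the aspect exponent `α` (outer box `Λ(⌈n^α⌉)`). [folklore] -/
def AtExponent (α : ℝ) : Prop :=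
  Tendsto (fun n : ℕ => critBond.real (twoClusterEvt n ⌈(n : ℝ) ^ α⌉₊)) atTop (𝓝 0)

/-- The crux is literally the instance `α = 7/6`. [folklore] -/
theorem nearLinearTwoClusterDecay_iff :
    PercShatteringRace.NearLinearTwoClusterDecay ↔ AtExponent ((7 : ℝ) / 6) := Iff.rfl

/-- The sibling crux `PercFiniteBoxLRO.CritBoxTwoArmsDecay` (stmt-CriticalPhenomena-0859) is
literally `∀ α > 1, AtExponent α`. [folklore] -/
theorem critBoxTwoArmsDecay_iff :
    PercFiniteBoxLRO.CritBoxTwoArmsDecay ↔ ∀ α : ℝ, 1 < α → AtExponent α := Iff.rfl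

/-! ## Tools -/

/-- Isolation: if `ω` uses only lattice edges and every lattice edge at `v` is closed, then `v` is
joined inside no `S` to any `w ≠ v`. [folklore] -/
theorem not_mem_openConnIn_of_incident_closed {ω : BondConfig (Site 3)}
    (hω : ω ⊆ (zdGraph 3).edgeSet) {v w : Site 3} (hvw : v ≠ w)
    (hcl : ∀ e ∈ (zdGraph 3).incidenceFinset v, e ∉ ω) (S : Set (Site 3)) :
    ω ∉ openConnIn S v w := by
  rintro ⟨hv, hw, h⟩
  have h' : (openGraph ω).Reachable v w := h.map (SimpleGraph.Embedding.induce S).toHom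
  obtain ⟨p⟩ := h'
  cases p with
  | nil => exact hvw rfl
  | @cons _ u _ hadj _ =>
    rw [openGraph_adj] at hadj
    have he : (zdGraph 3).Adj v u := (SimpleGraph.mem_edgeSet _).1 (hω hadj.1)
    have hinc : s(v, u) ∈ (zdGraph 3).incidenceFinset v := by
      rw [SimpleGraph.mem_incidenceFinset, SimpleGraph.mk'_mem_incidenceSet_left_iff]
      exact he
    exact hcl _ hinc hadj.1

/-- Closing a finite set `F` of pairs costs at most `(1 - p_c)^{|F|}`: if every lattice
configuration with all of `F` closed lies in `A`, then `P_{p_c}(A) ≥ (1 - p_c)^{|F|}`. [folklore] -/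
theorem pow_card_le_real_of_closed {A : Set (BondConfig (Site 3))} (F : Finset (Sym2 (Site 3)))
    (h : ∀ ω : BondConfig (Site 3), ω ⊆ (zdGraph 3).edgeSet → (∀ e ∈ F, e ∉ ω) → ω ∈ A) :
    (1 - (criticalProbI 3 : ℝ)) ^ F.card ≤ critBond.real A := by
  have hae : ∀ᵐ ω ∂critBond, ω ⊆ (zdGraph 3).edgeSet :=
    ProbabilityTheory.setBernoulli_ae_subset
  have hle : {ω : BondConfig (Site 3) | ∀ e ∈ F, e ∉ ω} ≤ᵐ[critBond] A :=
    hae.mono fun ω hω => show (ω ∈ {ω : BondConfig (Site 3) | ∀ e ∈ F, e ∉ ω}) → ω ∈ A from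
      fun hF => h ω hω hF
  calc (1 - (criticalProbI 3 : ℝ)) ^ F.card
      ≤ critBond.real {ω | ∀ e ∈ F, e ∉ ω} := le_bondPercolation_real_forall_notMem _ _ F
    _ ≤ critBond.real A := by
        simp only [measureReal_def]
        exact ENNReal.toReal_mono (measure_ne_top _ _) (measure_mono_ae hle)

/-- Every site of `ℤ³` has exactly `6` incident lattice edges. [folklore] -/
theorem card_incidenceFinset_zdGraph_three (v : Site 3) :
    ((zdGraph 3).incidenceFinset v).card = 6 := by
  classical
  rw [SimpleGraph.card_incidenceFinset_eq_degree, ← SimpleGraph.card_neighborFinset_eq_degree]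
  have := card_neighborFinset_zdGraph_holds (d := 3) v
  convert this using 1

/-! ## Geometry of the corner `(m,m,m)` -/

/-- The corner `(m, m, m)` of `Λ(m)`. [folklore] -/
def corner (m : ℕ) : Site 3 := fun _ => (m : ℤ)

/-- The corner of `Λ(m)` lies in every `Λ(n)`, `n ≥ m`. [folklore] -/
theorem corner_mem_box {m n : ℕ} (h : m ≤ n) : corner m ∈ box 3 n := by
  rw [mem_box]; intro i; simp only [corner]; omega

/-- The opposite corner `-(m,m,m)` lies in every `Λ(n)`, `n ≥ m`. [folklore] -/
theorem neg_corner_mem_box {m n : ℕ} (h : m ≤ n) : -corner m ∈ box 3 n := by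
  rw [mem_box]; intro i; simp only [corner, Pi.neg_apply]; omega

/-- `(m,m,m) ∈ ∂ⁱⁿΛ(m)` (its neighbour `(m+1,m,m)` is outside). [folklore] -/
theorem corner_mem_innerBoundary (m : ℕ) : corner m ∈ innerBoundary (zdGraph 3) (box 3 m) := by
  rw [mem_innerBoundary_iff]
  refine ⟨corner_mem_box le_rfl, corner m + Pi.single 0 1, ?_, ?_⟩
  · intro h
    rw [mem_box] at h
    have := (h 0).2
    simp only [corner, Pi.add_apply, Pi.single_eq_same] at this
    omega
  · rw [zdGraph_adj_iff]; exact ⟨0, Or.inl rfl⟩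

/-- `-(m,m,m) ∈ ∂ⁱⁿΛ(m)`. [folklore] -/
theorem neg_corner_mem_innerBoundary (m : ℕ) : -corner m ∈ innerBoundary (zdGraph 3) (box 3 m) := by
  rw [mem_innerBoundary_iff]
  refine ⟨neg_corner_mem_box le_rfl, -corner m - Pi.single 0 1, ?_, ?_⟩
  · intro h
    rw [mem_box] at h
    have := (h 0).1
    simp only [corner, Pi.sub_apply, Pi.neg_apply, Pi.single_eq_same] at this
    omega
  · rw [zdGraph_adj_iff]; exact ⟨0, Or.inr (by simp)⟩

/-- The two corners differ once `m ≥ 1`. [folklore] -/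
theorem corner_ne_neg {m : ℕ} (hm : 1 ≤ m) : corner m ≠ -corner m := by
  intro h
  have := congr_fun h 0
  simp only [corner, Pi.neg_apply] at this
  omega

/-! ## (a) Load-bearing analysis I: the aspect exponent must exceed `1` -/

/-- At aspect exponent `≤ 1` the event has probability `≥ (1 - p_c)^6` at every scale:
with `1 ≤ m ≤ n`, the corner `(m,m,m)` lies in `Λ(n) ∩ ∂ⁱⁿΛ(m)`, is (reflexively) joined to the
boundary, and is cut from `-(m,m,m)` as soon as its six edges are closed. [folklore] -/
theorem real_twoClusterEvt_ge {n m : ℕ} (hm1 : 1 ≤ m) (hmn : m ≤ n) :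
    (1 - (criticalProbI 3 : ℝ)) ^ 6 ≤ critBond.real (twoClusterEvt n m) := by
  classical
  rw [← card_incidenceFinset_zdGraph_three (corner m)]
  apply pow_card_le_real_of_closed
  intro ω hω hF
  refine ⟨corner m, corner_mem_box hmn, -corner m, neg_corner_mem_box hmn, corner m,
    corner_mem_innerBoundary m, -corner m, neg_corner_mem_innerBoundary m, ?_, ?_, ?_⟩
  · exact ⟨Finset.mem_coe.2 (corner_mem_box le_rfl), Finset.mem_coe.2 (corner_mem_box le_rfl),
      SimpleGraph.Reachable.refl _⟩
  · exact ⟨Finset.mem_coe.2 (neg_corner_mem_box le_rfl),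
      Finset.mem_coe.2 (neg_corner_mem_box le_rfl), SimpleGraph.Reachable.refl _⟩
  · exact not_mem_openConnIn_of_incident_closed hω (corner_ne_neg hm1) hF _

/-- **Any proof must use `α > 1`.** For every aspect exponent `α ≤ 1` (in particular `α = 1`,
outer box = inner box) the two-cluster probability stays `≥ (1 - p_c)^6`, so it does not tend
to `0`: `CritBoxTwoArmsDecay`'s hypothesis `1 < α` cannot be weakened to `1 ≤ α`, and the crux
`U(1/6)` is the `b = 1/6` member of a family that is FALSE at `b ≤ 0`. [folklore] -/
theorem not_atExponent_of_le_one {α : ℝ} (hα : α ≤ 1) : ¬ AtExponent α := by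
  intro h
  have hc : 0 < (1 - (criticalProbI 3 : ℝ)) ^ 6 := pow_pos (sub_pos.2
    (show ((criticalProbI 3 : unitInterval) : ℝ) < 1 by
      rw [coe_criticalProbI]; exact (Grimmett1999_criticalProb_pos_lt_one_holds 3 (by norm_num)).2)) 6
  obtain ⟨n, hlt, hn⟩ := ((h.eventually (Iio_mem_nhds hc)).and (eventually_ge_atTop 1)).exists
  have hn' : (1 : ℝ) ≤ n := by exact_mod_cast hn
  have hm_le : ⌈(n : ℝ) ^ α⌉₊ ≤ n := by
    refine Nat.ceil_le.2 ?_
    calc (n : ℝ) ^ α ≤ (n : ℝ) ^ (1 : ℝ) := Real.rpow_le_rpow_of_exponent_le hn' hα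
      _ = n := Real.rpow_one _
  have hm_pos : 1 ≤ ⌈(n : ℝ) ^ α⌉₊ :=
    Nat.lt_ceil.2 (by simpa using Real.rpow_pos_of_pos (by positivity : (0 : ℝ) < n) α)
  exact absurd (real_twoClusterEvt_ge hm_pos hm_le) (not_le.2 hlt)

/-- **The crux at aspect exponent `1` is false** (headline instance, spelled inline over tree
declarations: the crux with `7/6` replaced by `1`). [folklore] -/
theorem nearLinearTwoClusterDecay_false_at_aspect_one :
    ¬ Tendsto (fun n : ℕ => (bondPercolation (zdGraph 3) (criticalProbI 3)).real
      {ω | ∃ x ∈ box 3 n, ∃ x' ∈ box 3 n, ∃ y ∈ innerBoundary (zdGraph 3) (box 3 ⌈(n : ℝ) ^ (1 : ℝ)⌉₊),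
        ∃ y' ∈ innerBoundary (zdGraph 3) (box 3 ⌈(n : ℝ) ^ (1 : ℝ)⌉₊),
          ω ∈ openConnIn ↑(box 3 ⌈(n : ℝ) ^ (1 : ℝ)⌉₊) x y ∧
          ω ∈ openConnIn ↑(box 3 ⌈(n : ℝ) ^ (1 : ℝ)⌉₊) x' y' ∧
          ω ∉ openConnIn ↑(box 3 ⌈(n : ℝ) ^ (1 : ℝ)⌉₊) x x'}) atTop (𝓝 0) :=
  not_atExponent_of_le_one le_rfl

/-! ## (a) Load-bearing analysis II: the two arms to `∂ⁱⁿΛ(m)` cannot be dropped -/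

/-- `e₀ = (1,0,0) ∈ Λ(n)` for `n ≥ 1`. [folklore] -/
theorem single_mem_box {n : ℕ} (hn : 1 ≤ n) : (Pi.single 0 1 : Site 3) ∈ box 3 n := by
  rw [mem_box]; intro i
  by_cases hi : i = 0
  · subst hi; simp; omega
  · simp [hi]

/-- `P_{p_c}(∃ x, x' ∈ Λ(n) not joined inside S) ≥ (1 - p_c)^6` for `n ≥ 1`: close the six edges at the origin. [folklore] -/
theorem real_noConn_ge {n : ℕ} (hn : 1 ≤ n) (S : Set (Site 3)) :
    (1 - (criticalProbI 3 : ℝ)) ^ 6 ≤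
      critBond.real {ω | ∃ x ∈ box 3 n, ∃ x' ∈ box 3 n, ω ∉ openConnIn S x x'} := by
  classical
  rw [← card_incidenceFinset_zdGraph_three (0 : Site 3)]
  apply pow_card_le_real_of_closed
  intro ω hω hF
  refine ⟨0, zero_mem_box 3 n, Pi.single 0 1, single_mem_box hn, ?_⟩
  refine not_mem_openConnIn_of_incident_closed hω ?_ hF S
  intro h
  have := congr_fun h 0
  simp at this

/-- **Any proof must use the arms.** Without the two connections to `∂ⁱⁿΛ(m)` the event
contains "the origin is isolated", of probability `(1 - p_c)^6 > 0` at every scale. [folklore] -/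
theorem nearLinearTwoClusterDecay_false_without_arms :
    ¬ Tendsto (fun n : ℕ => (bondPercolation (zdGraph 3) (criticalProbI 3)).real
      {ω | ∃ x ∈ box 3 n, ∃ x' ∈ box 3 n,
        ω ∉ openConnIn ↑(box 3 ⌈(n : ℝ) ^ ((7 : ℝ) / 6)⌉₊) x x'}) atTop (𝓝 0) := by
  intro h
  have hc : 0 < (1 - (criticalProbI 3 : ℝ)) ^ 6 := pow_pos (sub_pos.2
    (show ((criticalProbI 3 : unitInterval) : ℝ) < 1 by
      rw [coe_criticalProbI]; exact (Grimmett1999_criticalProb_pos_lt_one_holds 3 (by norm_num)).2)) 6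
  obtain ⟨n, hlt, hn⟩ := ((h.eventually (Iio_mem_nhds hc)).and (eventually_ge_atTop 1)).exists
  exact absurd (real_noConn_ge hn _) (not_le.2 hlt)


end

end Summit.CriticalPhenomena.PercolationContinuityZ3.Theorems.NearLinearTwoClusterDecay.Negative
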